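import Literature.NumberTheory.Sieve.CFSemigroupTwistedRenewal
import Literature.NumberTheory.Sieve.CFSemigroupNormCount
import HarnessLib

/-!
# The congruence Frobenius-norm count for `Γ_A` (fixed modulus, main term)

Support file (all results proved) for the named fact
`Literature.NumberTheory.Sieve.MageeOhWinter2019_uniformCounting` (`CFSemigroupCounting.lean`).
**The main term of [MageeOhWinter2019, Thm. 1/Thm. 11] at a FIXED level `q`:** for `a ≠ b` in `A`
and `q ≥ 1` prime to `6 (b - a)`, there is `c_A > 0` with
`cfCount A 1 1 R ~ c_A R^{2δ_A}` and, for EVERY `ξ ∈ SL₂(ℤ/qℤ)`,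
`cfCount A q ξ R = #{γ ∈ Γ_A : ‖γ‖_F ≤ R, γ ≡ ξ (q)} ~ c_A R^{2δ_A} / #SL₂(ℤ/qℤ)` (`cfCount_congr_tendsto`):
the orbit of `Γ_A` equidistributes among the residue classes. (No power saving and no
uniformity in `q` — those are [MageeOhWinter2019, Thm. 4 / the appendix].) The proof is the
residue-class version of `CFSemigroupNormCount.lean`: words ↔ elements, suffix decomposition,
the Frobenius bridging sandwich, and the congruence renewal theorem `cfCongCountT_asymp` per
suffix (each class receives `1/#SL₂(ℤ/qℤ)` of the per-suffix main term, independently of `ξ`).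

## References

* M. Magee, H. Oh, D. Winter, J. reine angew. Math. 753 (2019) 89–135, Thm. 1, Thm. 11, §3. [MageeOhWinter2019]
-/

noncomputable section

open Set Filter Topology
open scoped MatrixGroups

namespace Literature.NumberTheory.Sieve

variable {A : Finset ℕ}

/-! ### Reductions of word matrices -/

/-- Reduction of an integer matrix modulo `q`. [folklore] -/
def cfRedMat (q : ℕ) (M : Matrix (Fin 2) (Fin 2) ℤ) : Matrix (Fin 2) (Fin 2) (ZMod q) :=
  (Int.castRingHom (ZMod q)).mapMatrix M

/-- Reduction is multiplicative. [folklore] -/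
theorem cfRedMat_mul (q : ℕ) (M N : Matrix (Fin 2) (Fin 2) ℤ) : cfRedMat q (M * N) = cfRedMat q M * cfRedMat q N :=
  map_mul _ _ _

/-- The matrix of `cfRed q γ` is the reduction of the matrix of `γ`. [folklore] -/
theorem coe_cfRed (q : ℕ) (γ : SL(2, ℤ)) : ((cfRed q γ : SL(2, ZMod q)) : Matrix (Fin 2) (Fin 2) (ZMod q)) = cfRedMat q γ := rfl

/-- `cfRed q γ = ξ` iff the reduced matrices agree. [folklore] -/
theorem cfRed_eq_iff (q : ℕ) (γ : SL(2, ℤ)) (ξ : SL(2, ZMod q)) :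
    cfRed q γ = ξ ↔ cfRedMat q (γ : Matrix (Fin 2) (Fin 2) ℤ) = (ξ : Matrix (Fin 2) (Fin 2) (ZMod q)) := by
  rw [← coe_cfRed]
  exact ⟨fun h => by rw [h], fun h => Subtype.ext h⟩

variable (A) in
/-- The path matrix as an element of `SL₂(ℤ)` (pairs have determinant one). [folklore] -/
def cfPathSL : List (A × A) → SL(2, ℤ)
  | [] => 1
  | p :: w => cfPathSL w * cfPair ((p.1 : A) : ℕ) ((p.2 : A) : ℕ)

/-- The matrix of `cfPathSL w` is `cfPathMat w`. [folklore] -/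
theorem coe_cfPathSL : ∀ w : List (A × A), ((cfPathSL A w : SL(2, ℤ)) : Matrix (Fin 2) (Fin 2) ℤ) = cfPathMat A w
  | [] => by simp [cfPathSL, cfPathMat]
  | p :: w => by
      rw [cfPathSL, cfPathMat, Matrix.SpecialLinearGroup.coe_mul, coe_cfPathSL w]
      rfl

/-- **The twist of a path is the inverse reduction of its matrix:** `σ_w = (π_q(M_w))⁻¹`. [folklore] -/
theorem cfSigmaWord_eq_inv (q : ℕ) : ∀ w : List (A × A), cfSigmaWord A q w = (cfRed q (cfPathSL A w))⁻¹
  | [] => by simp [cfPathSL]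
  | p :: w => by
      rw [show p :: w = [p] ++ w from rfl, cfSigmaWord_append, cfSigmaWord_singleton, cfSigmaWord_eq_inv q w,
        show [p] ++ w = p :: w from rfl, cfPathSL, map_mul, mul_inv_rev, cfSigma]

/-! ### The congruence norm counts by word length -/

variable (A) in
/-- `N_n^{norm}(R; ξ) = #{w ∈ Aⁿ : ‖M_w‖² ≤ R², M_w ≡ ξ (q)}` for `n` even nonzero, else `0`. [folklore] -/
def cfLenNormCountC (q : ℕ) (ξ : SL(2, ZMod q)) (n : ℕ) (R : ℝ) : ℝ :=
  if Even n ∧ n ≠ 0 then ∑ w : Fin n → A,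
    (if cfNormSq (cfMat fun i => ((w i : A) : ℕ)) ≤ R ^ 2 ∧ cfRedMat q (cfMat fun i => ((w i : A) : ℕ)) = (ξ : Matrix (Fin 2) (Fin 2) (ZMod q))
      then (1 : ℝ) else 0)
  else 0

variable (A) in
/-- The per-suffix congruence count `S_v(R; ξ) = Σ_m #{u ∈ A^{2m} : ‖M_u M_v‖² ≤ R², M_u M_v ≡ ξ (q)}`. [folklore] -/
def cfSuffixCountC (q : ℕ) (ξ : SL(2, ZMod q)) {N : ℕ} (v : Fin N → A) (R : ℝ) : ℝ :=
  ∑' m, ∑ u : Fin (2 * m) → A,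
    (if cfNormSq (cfMat (fun i => ((u i : A) : ℕ)) * cfMat (fun i => ((v i : A) : ℕ))) ≤ R ^ 2 ∧
        cfRedMat q (cfMat (fun i => ((u i : A) : ℕ)) * cfMat (fun i => ((v i : A) : ℕ))) = (ξ : Matrix (Fin 2) (Fin 2) (ZMod q))
      then (1 : ℝ) else 0)

section CountsC

variable (q : ℕ) (ξ : SL(2, ZMod q))

/-- Non-negativity. [folklore] -/
theorem cfLenNormCountC_nonneg (n : ℕ) (R : ℝ) : 0 ≤ cfLenNormCountC A q ξ n R := by
  unfold cfLenNormCountC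
  split_ifs
  · exact Finset.sum_nonneg fun _ _ => by split_ifs <;> norm_num
  · exact le_rfl

/-- The congruence count is at most the plain count. [folklore] -/
theorem cfLenNormCountC_le (n : ℕ) (R : ℝ) : cfLenNormCountC A q ξ n R ≤ cfLenNormCount A n R := by
  unfold cfLenNormCountC cfLenNormCount
  split_ifs
  · refine Finset.sum_le_sum fun w _ => ?_
    by_cases h : cfNormSq (cfMat fun i => ((w i : A) : ℕ)) ≤ R ^ 2
    · rw [if_pos h]; split_ifs <;> norm_num
    · rw [if_neg h, if_neg fun h' => h h'.1]
  · exact le_rfl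

/-- Vanishing for long words. [folklore] -/
theorem cfLenNormCountC_eq_zero (hA : ∀ a ∈ A, 1 ≤ a) {K : ℕ} {R : ℝ} (hK : R ^ 2 < (2 : ℝ) ^ K) {n : ℕ} (hn : K < n) :
    cfLenNormCountC A q ξ n R = 0 :=
  le_antisymm ((cfLenNormCountC_le q ξ n R).trans (le_of_eq (cfLenNormCount_eq_zero hA hK hn))) (cfLenNormCountC_nonneg q ξ n R)

/-- Finite support. [folklore] -/
theorem summable_cfLenNormCountC (hA : ∀ a ∈ A, 1 ≤ a) (R : ℝ) : Summable fun n => cfLenNormCountC A q ξ n R := by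
  obtain ⟨K, hK⟩ := exists_pow_two_gt R
  refine summable_of_ne_finset_zero (s := Finset.range (K + 1)) fun n hn => ?_
  rw [Finset.mem_range, not_lt] at hn
  exact cfLenNormCountC_eq_zero q ξ hA hK (by omega)

/-- The suffix summand vanishes for long prefixes. [folklore] -/
theorem suffix_summandC_eq_zero (hA : ∀ a ∈ A, 1 ≤ a) {N : ℕ} (v : Fin N → A) {K : ℕ} {R : ℝ}
    (hK : R ^ 2 < (2 : ℝ) ^ K) {m : ℕ} (hm : K < 2 * m + N) :
    ∑ u : Fin (2 * m) → A,
      (if cfNormSq (cfMat (fun i => ((u i : A) : ℕ)) * cfMat (fun i => ((v i : A) : ℕ))) ≤ R ^ 2 ∧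
          cfRedMat q (cfMat (fun i => ((u i : A) : ℕ)) * cfMat (fun i => ((v i : A) : ℕ))) = (ξ : Matrix (Fin 2) (Fin 2) (ZMod q))
        then (1 : ℝ) else 0) = 0 := by
  refine Finset.sum_eq_zero fun u _ => if_neg fun hu => ?_
  rw [← cfNormSq_cfMat_append] at hu
  have := length_le_of_cfNormSq_le hA (Fin.append u v) hK hu.1
  omega

/-- The suffix series has finite support. [folklore] -/
theorem summable_suffixC (hA : ∀ a ∈ A, 1 ≤ a) {N : ℕ} (v : Fin N → A) (R : ℝ) :
    Summable fun m => ∑ u : Fin (2 * m) → A,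
      (if cfNormSq (cfMat (fun i => ((u i : A) : ℕ)) * cfMat (fun i => ((v i : A) : ℕ))) ≤ R ^ 2 ∧
          cfRedMat q (cfMat (fun i => ((u i : A) : ℕ)) * cfMat (fun i => ((v i : A) : ℕ))) = (ξ : Matrix (Fin 2) (Fin 2) (ZMod q))
        then (1 : ℝ) else 0) := by
  obtain ⟨K, hK⟩ := exists_pow_two_gt R
  refine summable_of_ne_finset_zero (s := Finset.range (K + 1)) fun m hm => ?_
  rw [Finset.mem_range, not_lt] at hm
  exact suffix_summandC_eq_zero q ξ hA v hK (by omega)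

/-- The per-suffix congruence count is non-negative. [folklore] -/
theorem cfSuffixCountC_nonneg {N : ℕ} (v : Fin N → A) (R : ℝ) : 0 ≤ cfSuffixCountC A q ξ v R :=
  tsum_nonneg fun _ => Finset.sum_nonneg fun _ _ => by split_ifs <;> norm_num

end CountsC

/-! ### `cfCount A q ξ R` as a sum over even words -/

/-- **`cfCount A q ξ R = Σ_n N_n^{norm}(R; ξ)`** (words ↔ elements of `Γ_A`). [cite: MageeOhWinter2019, §2.1 II] -/
theorem cfCount_eq_tsum_congr (hA : ∀ a ∈ A, 1 ≤ a) (hne : A.Nonempty) (q : ℕ) (ξ : SL(2, ZMod q)) (R : ℝ) :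
    (cfCount A q ξ R : ℝ) = ∑' n, cfLenNormCountC A q ξ n R := by
  classical
  obtain ⟨K, hK⟩ := exists_pow_two_gt R
  set P : (Σ n : ℕ, Fin n → A) → Prop := fun x =>
    cfNormSq (cfMat fun i => ((x.2 i : A) : ℕ)) ≤ R ^ 2 ∧ cfRedMat q (cfMat fun i => ((x.2 i : A) : ℕ)) = (ξ : Matrix (Fin 2) (Fin 2) (ZMod q))
    with hP
  set S : Finset (Σ n : ℕ, Fin n → A) :=
    ((Finset.range (K + 1)).sigma fun n => (Finset.univ : Finset (Fin n → A))).filter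
      (fun x => Even x.1 ∧ x.1 ≠ 0 ∧ P x) with hS
  set f : (Σ n : ℕ, Fin n → A) → SL(2, ℤ) := fun x =>
    if h : Even x.1 ∧ x.1 ≠ 0 then ((cfToElement hne ⟨x, h⟩).1 : SL(2, ℤ)) else 1 with hf
  have hfS : ∀ x ∈ S, ∃ h : Even x.1 ∧ x.1 ≠ 0, f x = (cfToElement hne ⟨x, h⟩).1 ∧ P x := by
    intro x hx
    rw [hS, Finset.mem_filter] at hx
    exact ⟨⟨hx.2.1, hx.2.2.1⟩, by simp only [hf, dif_pos (And.intro hx.2.1 hx.2.2.1)], hx.2.2.2⟩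
  have himage : cfBallRes A q ξ R = f '' ↑S := by
    ext γ
    constructor
    · rintro ⟨hγ, hnorm, hred⟩
      obtain ⟨x, hx⟩ := (cfToElement_bijective hA hne).2 ⟨γ, hγ⟩
      have hmat : (γ : Matrix (Fin 2) (Fin 2) ℤ) = cfMat fun i => ((x.1.2 i : A) : ℕ) := by
        rw [← coe_cfToElement hne x, hx]
      have hnorm' : cfNormSq (cfMat fun i => ((x.1.2 i : A) : ℕ)) ≤ R ^ 2 := by rw [← hmat]; exact hnorm
      have hred' : cfRedMat q (cfMat fun i => ((x.1.2 i : A) : ℕ)) = (ξ : Matrix (Fin 2) (Fin 2) (ZMod q)) := by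
        rw [← hmat]; exact (cfRed_eq_iff q γ ξ).1 hred
      refine ⟨x.1, ?_, ?_⟩
      · rw [Finset.mem_coe, hS, Finset.mem_filter, Finset.mem_sigma, Finset.mem_range]
        exact ⟨⟨Nat.lt_succ_of_le (length_le_of_cfNormSq_le hA x.1.2 hK hnorm'), Finset.mem_univ _⟩,
          x.2.1, x.2.2, hnorm', hred'⟩
      · simp only [hf, dif_pos x.2]
        rw [hx]
    · rintro ⟨x, hx, rfl⟩
      obtain ⟨h, hfx, hnorm, hred⟩ := hfS x hx
      rw [hfx]
      refine ⟨(cfToElement hne ⟨x, h⟩).2, ?_, ?_⟩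
      · rw [coe_cfToElement hne ⟨x, h⟩]; exact hnorm
      · rw [cfRed_eq_iff, coe_cfToElement hne ⟨x, h⟩]; exact hred
  have hinj : Set.InjOn f ↑S := by
    intro x hx y hy hxy
    obtain ⟨hx', hfx, -⟩ := hfS x hx
    obtain ⟨hy', hfy, -⟩ := hfS y hy
    rw [hfx, hfy] at hxy
    have h := (cfToElement_bijective hA hne).1 (Subtype.ext hxy)
    exact congrArg Subtype.val h
  have hcard : cfCount A q ξ R = S.card := by
    rw [cfCount_eq, himage, hinj.ncard_image, Set.ncard_coe_finset]
  have hsum : (S.card : ℝ) = ∑ n ∈ Finset.range (K + 1), cfLenNormCountC A q ξ n R := by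
    rw [hS, Finset.card_filter, Nat.cast_sum, Finset.sum_sigma]
    refine Finset.sum_congr rfl fun n _ => ?_
    rw [cfLenNormCountC]
    simp only [Nat.cast_ite, Nat.cast_one, Nat.cast_zero]
    by_cases hpar : Even n ∧ n ≠ 0
    · rw [if_pos hpar]
      refine Finset.sum_congr rfl fun w _ => ?_
      by_cases hw : P ⟨n, w⟩
      · rw [if_pos ⟨hpar.1, hpar.2, hw⟩, if_pos hw]
      · rw [if_neg fun h => hw h.2.2, if_neg hw]
    · rw [if_neg hpar]
      refine Finset.sum_eq_zero fun w _ => if_neg fun h => hpar ⟨h.1, h.2.1⟩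
  rw [hcard, hsum, tsum_eq_sum]
  intro n hn
  rw [Finset.mem_range, not_lt] at hn
  exact cfLenNormCountC_eq_zero q ξ hA hK (by omega)

/-! ### The suffix decomposition -/

/-- **Suffix decomposition of the congruence norm count** (`N` even nonzero). [cite: MageeOhWinter2019, Lemma 14] -/
theorem tsum_cfLenNormCountC_split (hA : ∀ a ∈ A, 1 ≤ a) (q : ℕ) (ξ : SL(2, ZMod q)) {N : ℕ} (hN : Even N) (hN0 : N ≠ 0) (R : ℝ) :
    ∑' n, cfLenNormCountC A q ξ n R =
      ∑ n ∈ Finset.range N, cfLenNormCountC A q ξ n R + ∑ v : Fin N → A, cfSuffixCountC A q ξ v R := by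
  have hsum := summable_cfLenNormCountC q ξ hA R
  have h1 : ∑' n, cfLenNormCountC A q ξ n R =
      ∑ n ∈ Finset.range N, cfLenNormCountC A q ξ n R + ∑' n, cfLenNormCountC A q ξ (n + N) R :=
    (hsum.sum_add_tsum_nat_add N).symm
  have hodd : ∀ m, cfLenNormCountC A q ξ (2 * m + 1 + N) R = 0 := fun m => by
    unfold cfLenNormCountC
    rw [if_neg]
    rintro ⟨he, -⟩
    obtain ⟨k, hk⟩ := hN
    rw [Nat.even_iff] at he
    omega
  have heven : ∀ m, cfLenNormCountC A q ξ (2 * m + N) R = ∑ v : Fin N → A, ∑ u : Fin (2 * m) → A,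
      (if cfNormSq (cfMat (fun i => ((u i : A) : ℕ)) * cfMat (fun i => ((v i : A) : ℕ))) ≤ R ^ 2 ∧
          cfRedMat q (cfMat (fun i => ((u i : A) : ℕ)) * cfMat (fun i => ((v i : A) : ℕ))) = (ξ : Matrix (Fin 2) (Fin 2) (ZMod q))
        then (1 : ℝ) else 0) := by
    intro m
    unfold cfLenNormCountC
    have hpar : Even (2 * m + N) ∧ 2 * m + N ≠ 0 := ⟨(even_two_mul m).add hN, by omega⟩
    rw [if_pos hpar, ← (Fin.appendEquiv (2 * m) N).sum_comp, Fintype.sum_prod_type, Finset.sum_comm]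
    refine Finset.sum_congr rfl fun v _ => Finset.sum_congr rfl fun u _ => ?_
    show (if cfNormSq (cfMat fun i => ((Fin.append u v i : A) : ℕ)) ≤ R ^ 2 ∧
        cfRedMat q (cfMat fun i => ((Fin.append u v i : A) : ℕ)) = (ξ : Matrix (Fin 2) (Fin 2) (ZMod q)) then (1 : ℝ) else 0) = _
    rw [cfNormSq_cfMat_append, coe_append, cfMat_append]
  have hi : Function.Injective (fun m : ℕ => 2 * m + N) := fun a b h => by
    dsimp only at h; omega
  have hE : Summable fun m => cfLenNormCountC A q ξ (2 * m + N) R := hsum.comp_injective hi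
  have hO : Summable fun m : ℕ => cfLenNormCountC A q ξ (2 * m + 1 + N) R :=
    (summable_zero (α := ℝ) (β := ℕ)).congr fun m => (hodd m).symm
  have h2 : ∑' n, cfLenNormCountC A q ξ (n + N) R = ∑ v : Fin N → A, cfSuffixCountC A q ξ v R := by
    rw [← tsum_even_add_odd (f := fun n => cfLenNormCountC A q ξ (n + N) R) hE hO, tsum_congr hodd, tsum_zero, add_zero,
      tsum_congr heven]
    unfold cfSuffixCountC
    exact Summable.tsum_finsetSum fun v _ => summable_suffixC q ξ hA v R
  rw [h1, h2]

/-- The short words contribute a bounded amount. [folklore] -/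
theorem sum_cfLenNormCountC_le (q : ℕ) (ξ : SL(2, ZMod q)) (N : ℕ) (R : ℝ) :
    ∑ n ∈ Finset.range N, cfLenNormCountC A q ξ n R ≤ ∑ n ∈ Finset.range N, ((Fintype.card (Fin n → A) : ℕ) : ℝ) :=
  (Finset.sum_le_sum fun n _ => cfLenNormCountC_le q ξ n R).trans (sum_cfLenNormCount_le N R)

/-! ### Letter words of even length versus pair words -/

/-- Flattening is a bijection onto the letter words of length `2n`. [folklore] -/
theorem cfFlat_bijective (n : ℕ) : Function.Bijective (cfFlat A n) := by
  rw [Fintype.bijective_iff_injective_and_card]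
  refine ⟨cfFlat_injective A n, ?_⟩
  simp [Fintype.card_prod, pow_mul, sq]

/-- **The congruence threshold count of even letter words is a pair-word congruence count:** for `g ∈ SL₂(ℤ/qℤ)`,
`#{u ∈ A^{2m} : d_u(x) Φ(M_u x) ≤ X, M_u ≡ g} = N_m(X, x; g → 1; 𝟙, Φ)`. [folklore] -/
theorem sum_letter_eq_cfCongLenCountT (hA : ∀ a ∈ A, 1 ≤ a) (q : ℕ) (Θ : CfThreshold) (g : SL(2, ZMod q)) (m : ℕ)
    (X : ℝ) {x : ℝ} (hx : x ∈ Icc (0 : ℝ) 1) :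
    ∑ u : Fin (2 * m) → A,
        (if cfDenom (cfMat fun i => ((u i : A) : ℕ)) x * Θ.Φ (cfMoeb (cfMat fun i => ((u i : A) : ℕ)) x) ≤ X ∧
            cfRedMat q (cfMat fun i => ((u i : A) : ℕ)) = (g : Matrix (Fin 2) (Fin 2) (ZMod q)) then (1 : ℝ) else 0) =
      cfCongLenCountT A Θ (CfLip.const 1) g 1 m X x := by
  rw [cfCongLenCountT, ← (cfFlat_bijective (A := A) m).sum_comp]
  refine Finset.sum_congr rfl fun w _ => ?_
  obtain ⟨-, hpt, -⟩ := cfPathMat_spec A hA 0 (List.ofFn w) hx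
  rw [cfMat_cfFlat A m w, ← hpt, show (CfLip.const 1).extend (cfPathPoint A (List.ofFn w) x) = 1 from rfl, Complex.one_re, one_mul]
  -- the congruence conditions agree: `g σ_w = 1 ↔ π(M_w) = g`
  have hiff : cfRedMat q (cfPathMat A (List.ofFn w)) = (g : Matrix (Fin 2) (Fin 2) (ZMod q)) ↔ g * cfSigmaWord A q (List.ofFn w) = 1 := by
    rw [cfSigmaWord_eq_inv, mul_inv_eq_one]
    constructor
    · intro h
      exact ((cfRed_eq_iff q _ g).2 (by rw [coe_cfPathSL]; exact h)).symm
    · intro h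
      have := (cfRed_eq_iff q _ g).1 h.symm
      rwa [coe_cfPathSL] at this
  by_cases h1 : cfDenom (cfPathMat A (List.ofFn w)) x * Θ.Φ (cfPathPoint A (List.ofFn w) x) ≤ X
  · by_cases h2 : cfRedMat q (cfPathMat A (List.ofFn w)) = (g : Matrix (Fin 2) (Fin 2) (ZMod q))
    · rw [if_pos ⟨h1, h2⟩, if_pos (hiff.1 h2), if_pos h1, mul_one]
    · rw [if_neg fun h => h2 h.2, if_neg fun h => h2 (hiff.2 h), zero_mul]
  · rw [if_neg fun h => h1 h.1, if_neg h1, mul_zero]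

/-- The matrix of an even letter word as an element of `SL₂(ℤ)`. [folklore] -/
def cfEvenWordSL {N : ℕ} (hN : Even N) (v : Fin N → A) : SL(2, ℤ) :=
  ⟨cfMat fun i => ((v i : A) : ℕ), by
    rw [cfMat, det_cfWord, hN.neg_one_pow]⟩

/-- The matrix of `cfEvenWordSL`. [folklore] -/
@[simp] theorem coe_cfEvenWordSL {N : ℕ} (hN : Even N) (v : Fin N → A) :
    ((cfEvenWordSL hN v : SL(2, ℤ)) : Matrix (Fin 2) (Fin 2) ℤ) = cfMat fun i => ((v i : A) : ℕ) := rfl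

/-- **Moving the suffix to the target class:** `M_u M_v ≡ ξ ↔ M_u ≡ ξ π(M_v)⁻¹`. [folklore] -/
theorem cfRedMat_mul_suffix_iff (q : ℕ) (ξ : SL(2, ZMod q)) {N : ℕ} (hN : Even N) (v : Fin N → A) (M : Matrix (Fin 2) (Fin 2) ℤ) :
    cfRedMat q (M * cfMat fun i => ((v i : A) : ℕ)) = (ξ : Matrix (Fin 2) (Fin 2) (ZMod q)) ↔
      cfRedMat q M = ((ξ * (cfRed q (cfEvenWordSL hN v))⁻¹ : SL(2, ZMod q)) : Matrix (Fin 2) (Fin 2) (ZMod q)) := by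
  set gv := cfRed q (cfEvenWordSL hN v) with hgv
  have hgvmat : (gv : Matrix (Fin 2) (Fin 2) (ZMod q)) = cfRedMat q (cfMat fun i => ((v i : A) : ℕ)) := rfl
  have hunit : IsUnit ((gv : Matrix (Fin 2) (Fin 2) (ZMod q)).det) := by rw [gv.2]; exact isUnit_one
  rw [Matrix.SpecialLinearGroup.coe_mul, Matrix.SpecialLinearGroup.coe_inv, cfRedMat_mul]
  show cfRedMat q M * cfRedMat q (cfMat fun i => ((v i : A) : ℕ)) = _ ↔ cfRedMat q M = (ξ : Matrix (Fin 2) (Fin 2) (ZMod q)) * Matrix.adjugate gv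
  rw [← hgvmat]
  have hinv : (gv : Matrix (Fin 2) (Fin 2) (ZMod q)) * Matrix.adjugate gv = 1 := by
    rw [Matrix.mul_adjugate, gv.2, one_smul]
  have hinv' : Matrix.adjugate gv * (gv : Matrix (Fin 2) (Fin 2) (ZMod q)) = 1 := by
    rw [Matrix.adjugate_mul, gv.2, one_smul]
  constructor
  · intro h
    rw [← h, mul_assoc, hinv, mul_one]
  · intro h
    rw [h, mul_assoc, hinv', mul_one]

/-- **The sandwich of the per-suffix congruence count** (`η̄_N ≤ 1/16`, `N` even, `R ≥ 0`): with
`g = ξ π(M_v)⁻¹`,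
`N_q(R e^{-5η̄}/√C_v, x_v; g → 1; 𝟙, Φ) ≤ S_v(R; ξ) ≤ N_q(R e^{8η̄}/√C_v, x_v; g → 1; 𝟙, Φ)`.
[cite: MageeOhWinter2019, Lemma 14] -/
theorem cfSuffixCountC_sandwich (hA : ∀ a ∈ A, 1 ≤ a) (q : ℕ) (ξ : SL(2, ZMod q)) {N : ℕ} (hNev : Even N)
    (hN : cfEtaBar N ≤ 1 / 16) (v : Fin N → A) {R : ℝ} (hR : 0 ≤ R) :
    let Mv := cfMat fun i => ((v i : A) : ℕ)
    let x := cfMoeb Mv 0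
    let C := ‖cfDenC Mv Complex.I‖ ^ 2
    let g := ξ * (cfRed q (cfEvenWordSL hNev v))⁻¹
    cfCongCountT A cfΘ₀ (CfLip.const 1) g 1 (R * Real.exp (-(5 * cfEtaBar N)) / Real.sqrt C) x ≤ cfSuffixCountC A q ξ v R ∧
      cfSuffixCountC A q ξ v R ≤ cfCongCountT A cfΘ₀ (CfLip.const 1) g 1 (R * Real.exp (8 * cfEtaBar N) / Real.sqrt C) x := by
  intro Mv x C g
  have hx : x ∈ Icc (0 : ℝ) 1 := cfMoeb_cfMat_mem (one_le_coe_digit hA v) ⟨le_rfl, zero_le_one⟩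
  have hS := summable_suffixC q ξ hA v R
  constructor
  · refine Summable.tsum_le_tsum (fun m => ?_) (summable_cfCongLenCountT A hA cfΘ₀ _ g 1 hx _) hS
    rw [← sum_letter_eq_cfCongLenCountT hA q cfΘ₀ g m _ hx]
    refine Finset.sum_le_sum fun u _ => ?_
    by_cases h : cfDenom (cfMat fun i => ((u i : A) : ℕ)) x * cfΘ₀.Φ (cfMoeb (cfMat fun i => ((u i : A) : ℕ)) x) ≤
        R * Real.exp (-(5 * cfEtaBar N)) / Real.sqrt C ∧
          cfRedMat q (cfMat fun i => ((u i : A) : ℕ)) = (g : Matrix (Fin 2) (Fin 2) (ZMod q))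
    · rw [if_pos h, if_pos ⟨(threshold_sandwich hA hN u v hR).1 h.1, (cfRedMat_mul_suffix_iff q ξ hNev v _).2 h.2⟩]
    · rw [if_neg h]; split_ifs <;> norm_num
  · refine Summable.tsum_le_tsum (fun m => ?_) hS (summable_cfCongLenCountT A hA cfΘ₀ _ g 1 hx _)
    rw [← sum_letter_eq_cfCongLenCountT hA q cfΘ₀ g m _ hx]
    refine Finset.sum_le_sum fun u _ => ?_
    by_cases h : cfNormSq (cfMat (fun i => ((u i : A) : ℕ)) * Mv) ≤ R ^ 2 ∧
        cfRedMat q (cfMat (fun i => ((u i : A) : ℕ)) * Mv) = (ξ : Matrix (Fin 2) (Fin 2) (ZMod q))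
    · rw [if_pos h, if_pos ⟨(threshold_sandwich hA hN u v hR).2 h.1, (cfRedMat_mul_suffix_iff q ξ hNev v _).1 h.2⟩]
    · rw [if_neg h]; split_ifs <;> norm_num

/-! ### The per-suffix asymptotics and the comparison functions -/

section LimitC

variable (A) (hA : ∀ a ∈ A, 1 ≤ a) (h2 : 2 ≤ A.card) (q : ℕ) [NeZero q] {n₀ : ℕ}
  (hprim : ∀ n ≥ n₀, ∀ ξ η : SL(2, ZMod q), ∃ w : List (A × A), w.length = n ∧ ξ * cfSigmaWord A q w = η)
include hA h2 hprim

/-- **Per-suffix congruence asymptotics:** `N_q(a R, x_v; g → 1; 𝟙, Φ) R^{-2δ} → a^{2δ} |Γ_q|⁻¹ c_v`, the same for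
every class `g`. [cite: MageeOhWinter2019, Thm. 11] -/
theorem tendsto_suffix_cong {N : ℕ} (v : Fin N → A) {a : ℝ} (ha : 0 < a) (g : SL(2, ZMod q)) :
    Tendsto (fun R : ℝ => cfCongCountT A cfΘ₀ (CfLip.const 1) g 1 (a * R) (cfXvI A hA v) / R ^ (2 * cfDimension A)) atTop
      (𝓝 (a ^ (2 * cfDimension A) * ((Fintype.card (SL(2, ZMod q)) : ℝ)⁻¹ * cfEvenConst A hA h2 cfΘ₀ (CfLip.const 1) (cfXvI A hA v)))) :=
  tendsto_rescale _ ha (cfCongCountT_asymp A hA h2 cfΘ₀ hprim const_one_real_nonneg.1 const_one_real_nonneg.2 g 1 (cfXvI A hA v))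

/-- The lower per-suffix constant `L_N = Σ_v a₋(v)^{2δ} c_v`. [folklore] -/
def cfClassLower (N : ℕ) : ℝ :=
  ∑ v : Fin N → A, (Real.exp (-(5 * cfEtaBar N)) / Real.sqrt (‖cfDenC (cfMat fun i => ((v i : A) : ℕ)) Complex.I‖ ^ 2)) ^
    (2 * cfDimension A) * cfEvenConst A hA h2 cfΘ₀ (CfLip.const 1) (cfXvI A hA v)

/-- The upper per-suffix constant `U_N = Σ_v a₊(v)^{2δ} c_v`. [folklore] -/
def cfClassUpper (N : ℕ) : ℝ :=
  ∑ v : Fin N → A, (Real.exp (8 * cfEtaBar N) / Real.sqrt (‖cfDenC (cfMat fun i => ((v i : A) : ℕ)) Complex.I‖ ^ 2)) ^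
    (2 * cfDimension A) * cfEvenConst A hA h2 cfΘ₀ (CfLip.const 1) (cfXvI A hA v)

omit hprim in
/-- `U_N = e^{13 η̄_N 2δ} L_N`. [folklore] -/
theorem cfClassUpper_eq (N : ℕ) : cfClassUpper A hA h2 N = Real.exp (13 * cfEtaBar N * (2 * cfDimension A)) * cfClassLower A hA h2 N :=
  upper_eq_exp_mul_lower A hA h2 N

/-- The lower comparison function and its limit `|Γ_q|⁻¹ L_N`. [folklore] -/
theorem tendsto_lower_cong {N : ℕ} (hNev : Even N) (ξ : SL(2, ZMod q)) :
    Tendsto (fun R : ℝ => (∑ v : Fin N → A, cfCongCountT A cfΘ₀ (CfLip.const 1) (ξ * (cfRed q (cfEvenWordSL hNev v))⁻¹) 1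
        (Real.exp (-(5 * cfEtaBar N)) / Real.sqrt (‖cfDenC (cfMat fun i => ((v i : A) : ℕ)) Complex.I‖ ^ 2) * R) (cfXvI A hA v)) /
        R ^ (2 * cfDimension A)) atTop
      (𝓝 ((Fintype.card (SL(2, ZMod q)) : ℝ)⁻¹ * cfClassLower A hA h2 N)) := by
  unfold cfClassLower
  simp_rw [Finset.sum_div, Finset.mul_sum]
  refine tendsto_finsetSum _ fun v _ => ?_
  have h := tendsto_suffix_cong A hA h2 q hprim v (div_pos (Real.exp_pos (-(5 * cfEtaBar N))) (sqrt_Cv_pos A hA v))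
    (ξ * (cfRed q (cfEvenWordSL hNev v))⁻¹)
  convert h using 2; ring

/-- The upper comparison function and its limit `|Γ_q|⁻¹ U_N`. [folklore] -/
theorem tendsto_upper_cong {N : ℕ} (hNev : Even N) (ξ : SL(2, ZMod q)) (b : ℝ) :
    Tendsto (fun R : ℝ => (b + ∑ v : Fin N → A, cfCongCountT A cfΘ₀ (CfLip.const 1) (ξ * (cfRed q (cfEvenWordSL hNev v))⁻¹) 1
        (Real.exp (8 * cfEtaBar N) / Real.sqrt (‖cfDenC (cfMat fun i => ((v i : A) : ℕ)) Complex.I‖ ^ 2) * R) (cfXvI A hA v)) /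
        R ^ (2 * cfDimension A)) atTop
      (𝓝 ((Fintype.card (SL(2, ZMod q)) : ℝ)⁻¹ * cfClassUpper A hA h2 N)) := by
  have hδ : 0 < 2 * cfDimension A := by linarith [cfDimension_pos hA h2]
  unfold cfClassUpper
  simp_rw [add_div, Finset.sum_div, Finset.mul_sum]
  have h0 : Tendsto (fun R : ℝ => b / R ^ (2 * cfDimension A)) atTop (𝓝 0) :=
    tendsto_const_nhds.div_atTop (tendsto_rpow_atTop hδ)
  have h1 := tendsto_finsetSum (Finset.univ : Finset (Fin N → A)) fun v _ =>
    (tendsto_suffix_cong A hA h2 q hprim v (div_pos (Real.exp_pos (8 * cfEtaBar N)) (sqrt_Cv_pos A hA v))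
      (ξ * (cfRed q (cfEvenWordSL hNev v))⁻¹))
  have h := h0.add h1
  rw [zero_add] at h
  convert h using 2
  exact Finset.sum_congr rfl fun v _ => by ring

/-! ### The main theorem -/

/-- **Bounds for a residue class:** for `N` even nonzero with `η̄_N ≤ 1/16`, the normalised class count
`f_ξ(R) = cfCount A q ξ R / R^{2δ}` satisfies `|Γ_q|⁻¹ L_N ≤ liminf f_ξ` and `limsup f_ξ ≤ |Γ_q|⁻¹ U_N`,
and is bounded. [cite: MageeOhWinter2019, Thm. 11] -/
theorem congr_class_bounds (ξ : SL(2, ZMod q)) :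
    IsBoundedUnder (· ≤ ·) atTop (fun R => (cfCount A q ξ R : ℝ) / R ^ (2 * cfDimension A)) ∧
      IsBoundedUnder (· ≥ ·) atTop (fun R => (cfCount A q ξ R : ℝ) / R ^ (2 * cfDimension A)) ∧
      ∀ N : ℕ, Even N → N ≠ 0 → cfEtaBar N ≤ 1 / 16 →
        (Fintype.card (SL(2, ZMod q)) : ℝ)⁻¹ * cfClassLower A hA h2 N ≤
            liminf (fun R => (cfCount A q ξ R : ℝ) / R ^ (2 * cfDimension A)) atTop ∧
          limsup (fun R => (cfCount A q ξ R : ℝ) / R ^ (2 * cfDimension A)) atTop ≤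
            (Fintype.card (SL(2, ZMod q)) : ℝ)⁻¹ * cfClassUpper A hA h2 N := by
  set f : ℝ → ℝ := fun R => (cfCount A q ξ R : ℝ) / R ^ (2 * cfDimension A) with hfdef
  have hδ := cfDimension_pos hA h2
  have hne : A.Nonempty := nonempty_of_two_le_card h2
  set p : ℝ := 2 * cfDimension A with hp
  -- a priori bounds: `0 ≤ f ≤ c₂` eventually
  obtain ⟨c₂, hc₂, hup⟩ := cfCount_one_le hA h2
  have hf_le : ∀ᶠ R in atTop, f R ≤ c₂ := by
    filter_upwards [eventually_ge_atTop 1] with R hR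
    have hRp : 0 < R ^ p := Real.rpow_pos_of_pos (by linarith) p
    refine (div_le_iff₀ hRp).2 ((?_ : (cfCount A q ξ R : ℝ) ≤ cfCount A 1 1 R).trans (hup R hR))
    exact_mod_cast cfCount_le_cfCount_one A q ξ R
  have hf_ge : ∀ᶠ R in atTop, 0 ≤ f R := by
    filter_upwards [eventually_ge_atTop 1] with R hR
    exact div_nonneg (Nat.cast_nonneg _) (Real.rpow_nonneg (by linarith) p)
  have hbdd_le : IsBoundedUnder (· ≤ ·) atTop f := isBoundedUnder_of_eventually_le hf_le
  have hbdd_ge : IsBoundedUnder (· ≥ ·) atTop f := isBoundedUnder_of_eventually_ge hf_ge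
  have hco_le : IsCoboundedUnder (· ≤ ·) atTop f := hbdd_ge.isCoboundedUnder_le
  have hco_ge : IsCoboundedUnder (· ≥ ·) atTop f := hbdd_le.isCoboundedUnder_ge
  refine ⟨hbdd_le, hbdd_ge, fun N hNev hN0 hη => ?_⟩
  set b : ℝ := ∑ n ∈ Finset.range N, ((Fintype.card (Fin n → A) : ℕ) : ℝ) with hb
  set gU : ℝ → ℝ := fun R => (b + ∑ v : Fin N → A, cfCongCountT A cfΘ₀ (CfLip.const 1) (ξ * (cfRed q (cfEvenWordSL hNev v))⁻¹) 1
      (Real.exp (8 * cfEtaBar N) / Real.sqrt (‖cfDenC (cfMat fun i => ((v i : A) : ℕ)) Complex.I‖ ^ 2) * R) (cfXvI A hA v)) /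
      R ^ p with hgU
  set gL : ℝ → ℝ := fun R => (∑ v : Fin N → A, cfCongCountT A cfΘ₀ (CfLip.const 1) (ξ * (cfRed q (cfEvenWordSL hNev v))⁻¹) 1
      (Real.exp (-(5 * cfEtaBar N)) / Real.sqrt (‖cfDenC (cfMat fun i => ((v i : A) : ℕ)) Complex.I‖ ^ 2) * R) (cfXvI A hA v)) /
      R ^ p with hgL
  have htU := tendsto_upper_cong A hA h2 q hprim hNev ξ b
  have htL := tendsto_lower_cong A hA h2 q hprim hNev ξ
  have hcmp : ∀ R : ℝ, 0 < R → gL R ≤ f R ∧ f R ≤ gU R := by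
    intro R hR
    have hRp : 0 < R ^ p := Real.rpow_pos_of_pos hR p
    have hcount : (cfCount A q ξ R : ℝ) =
        ∑ n ∈ Finset.range N, cfLenNormCountC A q ξ n R + ∑ v : Fin N → A, cfSuffixCountC A q ξ v R := by
      rw [cfCount_eq_tsum_congr hA hne q ξ R, tsum_cfLenNormCountC_split hA q ξ hNev hN0 R]
    have hsand := fun v : Fin N → A => cfSuffixCountC_sandwich hA q ξ hNev hη v hR.le
    constructor
    · refine div_le_div_of_nonneg_right ?_ hRp.le
      rw [hcount]
      have h0 : 0 ≤ ∑ n ∈ Finset.range N, cfLenNormCountC A q ξ n R := Finset.sum_nonneg fun n _ => cfLenNormCountC_nonneg q ξ n R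
      have h1 : ∑ v : Fin N → A, cfCongCountT A cfΘ₀ (CfLip.const 1) (ξ * (cfRed q (cfEvenWordSL hNev v))⁻¹) 1
          (Real.exp (-(5 * cfEtaBar N)) / Real.sqrt (‖cfDenC (cfMat fun i => ((v i : A) : ℕ)) Complex.I‖ ^ 2) * R) (cfXvI A hA v) ≤
          ∑ v : Fin N → A, cfSuffixCountC A q ξ v R := by
        refine Finset.sum_le_sum fun v _ => ?_
        have h := (hsand v).1
        rwa [show R * Real.exp (-(5 * cfEtaBar N)) / Real.sqrt (‖cfDenC (cfMat fun i => ((v i : A) : ℕ)) Complex.I‖ ^ 2) =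
          Real.exp (-(5 * cfEtaBar N)) / Real.sqrt (‖cfDenC (cfMat fun i => ((v i : A) : ℕ)) Complex.I‖ ^ 2) * R by ring] at h
      linarith
    · refine div_le_div_of_nonneg_right ?_ hRp.le
      rw [hcount]
      have h0 := sum_cfLenNormCountC_le (A := A) q ξ N R
      have h1 : ∑ v : Fin N → A, cfSuffixCountC A q ξ v R ≤ ∑ v : Fin N → A, cfCongCountT A cfΘ₀ (CfLip.const 1)
          (ξ * (cfRed q (cfEvenWordSL hNev v))⁻¹) 1
          (Real.exp (8 * cfEtaBar N) / Real.sqrt (‖cfDenC (cfMat fun i => ((v i : A) : ℕ)) Complex.I‖ ^ 2) * R) (cfXvI A hA v) := by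
        refine Finset.sum_le_sum fun v _ => ?_
        have h := (hsand v).2
        rwa [show R * Real.exp (8 * cfEtaBar N) / Real.sqrt (‖cfDenC (cfMat fun i => ((v i : A) : ℕ)) Complex.I‖ ^ 2) =
          Real.exp (8 * cfEtaBar N) / Real.sqrt (‖cfDenC (cfMat fun i => ((v i : A) : ℕ)) Complex.I‖ ^ 2) * R by ring] at h
      linarith
  have hfU : ∀ᶠ R in atTop, f R ≤ gU R := (eventually_gt_atTop 0).mono fun R hR => (hcmp R hR).2
  have hfL : ∀ᶠ R in atTop, gL R ≤ f R := (eventually_gt_atTop 0).mono fun R hR => (hcmp R hR).1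
  constructor
  · rw [← htL.liminf_eq]
    exact liminf_le_liminf hfL htL.isBoundedUnder_ge hco_ge
  · rw [← htU.limsup_eq]
    exact limsup_le_limsup hfU hco_le htU.isBoundedUnder_le

/-- **Cross-class comparison:** `limsup f_ξ ≤ e^{13 η̄_N · 2δ} liminf f_{ξ'}` for every even `N ≠ 0`
with `η̄_N ≤ 1/16` and all classes `ξ, ξ'`. [cite: MageeOhWinter2019, Thm. 11] -/
theorem congr_class_cross (ξ ξ' : SL(2, ZMod q)) {N : ℕ} (hNev : Even N) (hN0 : N ≠ 0) (hη : cfEtaBar N ≤ 1 / 16) :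
    limsup (fun R => (cfCount A q ξ R : ℝ) / R ^ (2 * cfDimension A)) atTop ≤
      Real.exp (13 * cfEtaBar N * (2 * cfDimension A)) * liminf (fun R => (cfCount A q ξ' R : ℝ) / R ^ (2 * cfDimension A)) atTop := by
  obtain ⟨-, -, hb⟩ := congr_class_bounds A hA h2 q hprim ξ
  obtain ⟨-, -, hb'⟩ := congr_class_bounds A hA h2 q hprim ξ'
  have hU := (hb N hNev hN0 hη).2
  have hL := (hb' N hNev hN0 hη).1
  rw [cfClassUpper_eq A hA h2 N, mul_left_comm] at hU
  exact hU.trans (mul_le_mul_of_nonneg_left hL (Real.exp_pos _).le)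

/-- **Each residue class has a limit, the same for all classes.** [cite: MageeOhWinter2019, Thm. 11] -/
theorem congr_class_limsup_le_liminf (ξ ξ' : SL(2, ZMod q)) :
    limsup (fun R => (cfCount A q ξ R : ℝ) / R ^ (2 * cfDimension A)) atTop ≤
      liminf (fun R => (cfCount A q ξ' R : ℝ) / R ^ (2 * cfDimension A)) atTop := by
  set p : ℝ := 2 * cfDimension A
  set l' := liminf (fun R => (cfCount A q ξ' R : ℝ) / R ^ p) atTop
  obtain ⟨hbdd_le', hbdd_ge', -⟩ := congr_class_bounds A hA h2 q hprim ξ'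
  have hl'0 : 0 ≤ l' := by
    refine le_liminf_of_le hbdd_le'.isCoboundedUnder_ge ?_
    filter_upwards [eventually_ge_atTop 1] with R hR
    exact div_nonneg (Nat.cast_nonneg _) (Real.rpow_nonneg (by linarith) p)
  have hlimfac : Tendsto (fun k : ℕ => Real.exp (13 * cfEtaBar (2 * k) * p) * l') atTop (𝓝 (1 * l')) := by
    refine Tendsto.mul_const _ ?_
    rw [← Real.exp_zero]
    refine (Real.continuous_exp.tendsto 0).comp ?_
    have hη : Tendsto (fun k : ℕ => cfEtaBar (2 * k)) atTop (𝓝 0) := by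
      have hg : Tendsto (fun n : ℕ => (1 / 2 : ℝ) ^ n) atTop (𝓝 0) :=
        tendsto_pow_atTop_nhds_zero_of_lt_one (by norm_num) (by norm_num)
      have hidx : Tendsto (fun k : ℕ => 2 * k - 1) atTop atTop :=
        tendsto_atTop_atTop.2 fun b => ⟨b + 1, fun k hk => by omega⟩
      exact hg.comp hidx
    simpa using (hη.mul_const p).const_mul 13 |>.congr' (Eventually.of_forall fun k => by ring)
  rw [one_mul] at hlimfac
  refine ge_of_tendsto' hlimfac fun k => ?_
  rcases Nat.lt_or_ge k 3 with hk | hk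
  · have h6 : cfEtaBar 6 ≤ 1 / 16 := by unfold cfEtaBar; norm_num
    have hk6 := congr_class_cross A hA h2 q hprim ξ ξ' (N := 6) (by decide) (by norm_num) h6
    refine hk6.trans (mul_le_mul_of_nonneg_right (Real.exp_le_exp.2 ?_) hl'0)
    have : cfEtaBar 6 ≤ cfEtaBar (2 * k) := by
      unfold cfEtaBar
      exact pow_le_pow_of_le_one (by norm_num) (by norm_num) (by omega)
    have hp0 : 0 ≤ p := by have := cfDimension_pos hA h2; positivity
    nlinarith [cfEtaBar_nonneg 6]
  · refine congr_class_cross A hA h2 q hprim ξ ξ' (N := 2 * k) (even_two_mul k) (by omega) ?_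
    unfold cfEtaBar
    calc (1 / 2 : ℝ) ^ (2 * k - 1) ≤ (1 / 2 : ℝ) ^ 5 := pow_le_pow_of_le_one (by norm_num) (by norm_num) (by omega)
      _ ≤ 1 / 16 := by norm_num

/-- **Convergence for each residue class**, with a limit independent of the class. [cite: MageeOhWinter2019, Thm. 11] -/
theorem congr_class_tendsto :
    ∃ l : ℝ, ∀ ξ : SL(2, ZMod q), Tendsto (fun R => (cfCount A q ξ R : ℝ) / R ^ (2 * cfDimension A)) atTop (𝓝 l) := by
  refine ⟨limsup (fun R => (cfCount A q 1 R : ℝ) / R ^ (2 * cfDimension A)) atTop, fun ξ => ?_⟩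
  obtain ⟨hbdd_le, hbdd_ge, -⟩ := congr_class_bounds A hA h2 q hprim ξ
  have h1 := congr_class_limsup_le_liminf A hA h2 q hprim ξ ξ
  have h2' := congr_class_limsup_le_liminf A hA h2 q hprim 1 ξ
  have h3 := congr_class_limsup_le_liminf A hA h2 q hprim ξ 1
  have hinfle : liminf (fun R => (cfCount A q ξ R : ℝ) / R ^ (2 * cfDimension A)) atTop ≤
      limsup (fun R => (cfCount A q ξ R : ℝ) / R ^ (2 * cfDimension A)) atTop := liminf_le_limsup hbdd_le hbdd_ge
  obtain ⟨hbdd_le1, hbdd_ge1, -⟩ := congr_class_bounds A hA h2 q hprim 1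
  have hinfle1 : liminf (fun R => (cfCount A q 1 R : ℝ) / R ^ (2 * cfDimension A)) atTop ≤
      limsup (fun R => (cfCount A q 1 R : ℝ) / R ^ (2 * cfDimension A)) atTop := liminf_le_limsup hbdd_le1 hbdd_ge1
  -- `limsup_1 ≤ liminf_ξ ≤ limsup_ξ ≤ liminf_1 ≤ limsup_1`
  have heq_inf : liminf (fun R => (cfCount A q ξ R : ℝ) / R ^ (2 * cfDimension A)) atTop =
      limsup (fun R => (cfCount A q 1 R : ℝ) / R ^ (2 * cfDimension A)) atTop := le_antisymm (hinfle.trans (h3.trans hinfle1)) h2'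
  have heq_sup : limsup (fun R => (cfCount A q ξ R : ℝ) / R ^ (2 * cfDimension A)) atTop =
      limsup (fun R => (cfCount A q 1 R : ℝ) / R ^ (2 * cfDimension A)) atTop := le_antisymm (h3.trans hinfle1) (h2'.trans hinfle)
  exact tendsto_of_le_liminf_of_limsup_le (by rw [heq_inf]) (by rw [heq_sup]) hbdd_le hbdd_ge

end LimitC

/-- **The congruence Frobenius-norm count for `Γ_A` at a fixed level — the main term of
[MageeOhWinter2019, Thm. 1 / Thm. 11] without error term:** let `a ≠ b` be letters of `A` and `q ≥ 1` be
prime to `6` and to `b - a`. Then there is `c > 0` such that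
`cfCount A 1 1 R = #{γ ∈ Γ_A : ‖γ‖_F ≤ R} ~ c R^{2δ_A}` and, for EVERY `ξ ∈ SL₂(ℤ/qℤ)`,
`cfCount A q ξ R = #{γ ∈ Γ_A : ‖γ‖_F ≤ R, γ ≡ ξ (q)} ~ c R^{2δ_A} / #SL₂(ℤ/qℤ)`.
(The fact `MageeOhWinter2019_uniformCounting` asserts in addition a power saving uniform in `q`, which
requires [MageeOhWinter2019, Thm. 4].) [cite: MageeOhWinter2019, Thm. 11] -/
theorem cfCount_congr_tendsto (hA : ∀ a ∈ A, 1 ≤ a) (h2 : 2 ≤ A.card) {a b : ℕ} (ha : a ∈ A) (hb : b ∈ A)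
    {q : ℕ} [NeZero q] (hq6 : Nat.Coprime q 6) (hq : IsCoprime ((b : ℤ) - a) q) :
    ∃ c : ℝ, 0 < c ∧ Tendsto (fun R : ℝ => (cfCount A 1 1 R : ℝ) / R ^ (2 * cfDimension A)) atTop (𝓝 c) ∧
      ∀ ξ : SL(2, ZMod q), Tendsto (fun R : ℝ => (cfCount A q ξ R : ℝ) / R ^ (2 * cfDimension A)) atTop
        (𝓝 (c / Fintype.card (SL(2, ZMod q)))) := by
  obtain ⟨n₀, hprim⟩ := cfTwist_primitive ha hb hq6 hq
  obtain ⟨l, hl⟩ := congr_class_tendsto A hA h2 q hprim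
  have hcard : (0 : ℝ) < Fintype.card (SL(2, ZMod q)) := by exact_mod_cast Fintype.card_pos
  -- the total count is the sum of the class counts
  have htot : Tendsto (fun R : ℝ => (cfCount A 1 1 R : ℝ) / R ^ (2 * cfDimension A)) atTop
      (𝓝 (Fintype.card (SL(2, ZMod q)) * l)) := by
    have h := tendsto_finsetSum (Finset.univ : Finset (SL(2, ZMod q))) fun ξ _ => hl ξ
    rw [Finset.sum_const, Finset.card_univ, nsmul_eq_mul] at h
    refine h.congr fun R => ?_
    rw [← Finset.sum_div, ← Nat.cast_sum, sum_cfCount_eq]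
  -- positivity from the lower bound for the total count
  obtain ⟨R₀, hR₀, c₁, hc₁, hlow⟩ := le_cfCount_one hA h2
  have hpos : 0 < Fintype.card (SL(2, ZMod q)) * l := by
    refine lt_of_lt_of_le hc₁ (ge_of_tendsto htot ?_)
    filter_upwards [eventually_ge_atTop (max R₀ 1)] with R hR
    have hRp : 0 < R ^ (2 * cfDimension A) := Real.rpow_pos_of_pos (by linarith [le_max_right R₀ 1]) _
    exact (le_div_iff₀ hRp).2 (hlow R ((le_max_left _ _).trans hR))
  refine ⟨Fintype.card (SL(2, ZMod q)) * l, hpos, htot, fun ξ => ?_⟩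
  rw [mul_div_cancel_left₀ _ hcard.ne']
  exact hl ξ

end Literature.NumberTheory.Sieve
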